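import Mathlib
import HarnessLib
import Literature.AlgebraicGeometry.Resolution.BlowupAlgebraPresentation
import Literature.AlgebraicGeometry.Resolution.RegularLocalRingsProofs
import Literature.AlgebraicGeometry.Resolution.RegularSystemOfParameters

/-!
# Kollár–Szabó going down, toward (P2): the exceptional quotient `S[𝔪/x_i]/(x_i)` of the point-blow-up chart of a
# regular local ring is a regular ring of dimension `d - 1`
# (crux `WildQuotients.WildQuotientResolution`, stub `stub_phaseZeroHighDim`)

Crux stmt-ResolutionOfSingularities-15640 (`WildQuotientResolution`), registered stub `stub_phaseZeroHighDim`; programme: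
`KollarSzaboGoingDown_holds` via ✓`kollarSzaboGoingDown_of_localStepLE`; remaining item (P2) of memo KS-GOINGDOWN-ASSEMBLY.md:
`R₁/(t)` is regular local of dimension `≤ n` for the equivariant quadratic transform `R₁ = S[𝔪/t]_𝔫`. The ring-level core,
in the tree's abstract chart model `blowupAlgebra 𝔪 (x i)` (✓`BlowupAlgebraPresentation`: `S[𝔪/x_i]/(x_i) ≅ κ[T_j : j ≠ i]`,
Stacks 0BIQ):

* `isRegularRing_blowupAlgebra_quotient_span` — for `S` regular local with regular system of parameters `x`, the quotient
  `S[𝔪/x_i]/(x_i)` is a REGULAR RING (a polynomial ring over the residue field; Mathlib `MvPolynomial.isRegularRing_of_isRegularRing`);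
* `ringKrullDim_blowupAlgebra_quotient_span` — its dimension is `#{j ≠ i}` (Mathlib `MvPolynomial.ringKrullDim_of_isNoetherianRing`);
* `ringKrullDim_localization_atPrime_le` — `dim Q_𝔭 ≤ dim Q`; hence (with Mathlib's `IsRegularRing.isRegularLocalRing_localization`)
  every localisation of `S[𝔪/x_i]/(x_i)` at a prime is a regular local ring of dimension `≤ #{j ≠ i}` (the local rings of the
  exceptional divisor `E ≅ 𝔸^{d-1}_κ` of the chart; at the chart origin: `R₁/(t)`).

What remains for (P2): transport along `blowupAlgebra ≅ blowupRing S (x i) ⊆ K` (as built inside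
✓`EigenlineChart.exists_originHom_blowupRing`) and localisation/quotient commutation (Mathlib instance
`IsLocalization (algebraMapSubmonoid (R ⧸ I) M) (S ⧸ I.map (algebraMap R S))`) to `R₁ = LocalSubring.ofPrime (blowupRing S (x i)) 𝔫`.

[OURS · crux stmt-ResolutionOfSingularities-15640 · helper toward `stub_phaseZeroHighDim` ((P2) core; NOT a proof of the stub); counted 0;
AI-level work, weaker than expert review.] [cite: StacksProject, Tag 0BIQ]
-/

-- single-problem summit: the doubled namespace component `ResolutionOfSingularities` is forced
set_option linter.dupNamespace false

noncomputable section

open IsLocalRing Literature.AlgebraicGeometry.Resolution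

namespace Summit.ResolutionOfSingularities.ResolutionOfSingularities.Theorems.WildQuotientResolution.KSGoingDown

universe u

variable {S : Type u} [CommRing S] [IsRegularLocalRing S] {d : ℕ}
  (hd : (maximalIdeal S).spanFinrank = d) (x : Fin d → S) (hx : Ideal.span (Set.range x) = maximalIdeal S) (i : Fin d)

include hd hx

/-- **`S[𝔪/x_i]/(x_i)` is a regular ring** (≅ `κ(S)[T_j : j ≠ i]`). [cite: StacksProject, Tag 0BIQ] -/
theorem isRegularRing_blowupAlgebra_quotient_span :
    IsRegularRing (blowupAlgebra (Ideal.span (Set.range x)) (x i) ⧸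
      Ideal.span {algebraMap S (blowupAlgebra (Ideal.span (Set.range x)) (x i)) (x i)}) := by
  haveI : (Ideal.span (Set.range x)).IsMaximal := hx ▸ IsLocalRing.maximalIdeal.isMaximal S
  letI : Field (S ⧸ Ideal.span (Set.range x)) := Ideal.Quotient.field (Ideal.span (Set.range x))
  have hq := isQuasiRegular_regularSystemOfParameters hd x hx
  haveI : IsRegularRing (MvPolynomial {j : Fin d // j ≠ i} (S ⧸ Ideal.span (Set.range x))) := inferInstance
  exact IsRegularRing.of_ringEquiv (blowupAlgebra.quotientSpanEquiv x i hq).symm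

/-- **`dim S[𝔪/x_i]/(x_i) = #{j ≠ i}`**. [cite: StacksProject, Tag 0BIQ] -/
theorem ringKrullDim_blowupAlgebra_quotient_span :
    ringKrullDim (blowupAlgebra (Ideal.span (Set.range x)) (x i) ⧸
      Ideal.span {algebraMap S (blowupAlgebra (Ideal.span (Set.range x)) (x i)) (x i)}) =
      Nat.card {j : Fin d // j ≠ i} := by
  haveI : (Ideal.span (Set.range x)).IsMaximal := hx ▸ IsLocalRing.maximalIdeal.isMaximal S
  letI : Field (S ⧸ Ideal.span (Set.range x)) := Ideal.Quotient.field (Ideal.span (Set.range x))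
  have hq := isQuasiRegular_regularSystemOfParameters hd x hx
  rw [ringKrullDim_eq_of_ringEquiv (blowupAlgebra.quotientSpanEquiv x i hq),
    MvPolynomial.ringKrullDim_of_isNoetherianRing, ringKrullDim_eq_zero_of_isField (Field.toIsField _), zero_add]

omit [IsRegularLocalRing S] hd hx in
/-- The localisation of a ring at a prime has dimension at most that of the ring (`dim Q_𝔭 = ht 𝔭 ≤ dim Q`); with
`isRegularRing_blowupAlgebra_quotient_span` / `ringKrullDim_blowupAlgebra_quotient_span` (and Mathlib's instance
`IsRegularRing.isRegularLocalRing_localization`): every local ring of `S[𝔪/x_i]/(x_i)` is regular of dimension `≤ #{j ≠ i}`.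
[folklore] -/
theorem ringKrullDim_localization_atPrime_le {Q : Type u} [CommRing Q] (𝔭 : Ideal Q) [𝔭.IsPrime] :
    ringKrullDim (Localization.AtPrime 𝔭) ≤ ringKrullDim Q := by
  rw [IsLocalization.AtPrime.ringKrullDim_eq_height 𝔭 (Localization.AtPrime 𝔭)]
  exact Ideal.height_le_ringKrullDim_of_ne_top Ideal.IsPrime.ne_top'

end Summit.ResolutionOfSingularities.ResolutionOfSingularities.Theorems.WildQuotientResolution.KSGoingDown

end
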